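import Literature.Computability.Complexity.CoinChunks
import HarnessLib

/-!
# Rejection sampling from coin blocks: failure of a group, and the conditional law of the first accepted values

Topic `Computability/Complexity`, companion of `CoinChunks.lean` (coins ↔ tuples of block values) and
`UniformProbBlocks.lean` (union bound). A coin-driven machine that needs `T` independent uniform elements of a
polynomial-time recognisable set `G = {v < 2^B | P v}` (e.g. uniform primes `≤ X`) reads `T` GROUPS of `M` blocks of
`B` coins and keeps, in each group, the FIRST block value in `G` (REJECTION SAMPLING; Devroye 1986, §II.3;
Motwani–Raghavan 1995). Proved here in the tree's `uniformProb` model by exact counting on `Fin T → Fin M → Fin 2^B`: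
(i) a group has no accepted value in `#(¬G)^M` of the `#α^M` cases, so SOME group fails with probability
`≤ T (1 − #G/2^B)^M`; (ii) CONDITIONED on every group succeeding, the first accepted values are independent and
uniform on `G` — the number of groups whose first accepted value is `a ∈ G` does not depend on `a` (replacing the
first accepted entry by `a'` is a bijection between fibres, `card_fibre_eq`), and across groups the event is a
product — so a set of bad `T`-tuples of density `≤ β` in `G^T` is hit with probability `≤ β`
(`uniformProb_blockRejection_le`, written with `List.find?` / `List.filterMap` on the block values `bitsToNat`, as a
program reads them; definition-free). Consumer: the sampler of the crux `LinnikCubicClassGroups.PureCubicClassGroupFBQP`.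

## References

* L. Devroye, *Non-Uniform Random Variate Generation*, Springer 1986, §II.3 (the rejection method).
* R. Motwani, P. Raghavan, *Randomized Algorithms*, CUP 1995, §1 and Appendix C.
* S. Arora, B. Barak, *Computational Complexity: A Modern Approach*, CUP 2009, §7.1, §A.2.
-/

namespace Literature.Computability.Complexity

open Finset

namespace BlockRejection

variable {α : Type} [Fintype α] [DecidableEq α] {M : ℕ} (P : α → Prop) [DecidablePred P]

/-! ### One group: the first accepted value -/

omit [Fintype α] [DecidableEq α] in
/-- The first accepted value of a group is `a` iff the first accepted INDEX is in range and carries `a`. [folklore] -/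
theorem find?_ofFn_eq_some_iff (f : Fin M → α) (a : α) :
    (List.ofFn f).find? (fun b => decide (P b)) = some a ↔
      ∃ h : (List.ofFn f).findIdx (fun b => decide (P b)) < M, f ⟨_, h⟩ = a := by
  rw [List.find?_eq_getElem?_findIdx, List.getElem?_eq_some_iff]
  constructor
  · rintro ⟨hlt, heq⟩
    rw [List.length_ofFn] at hlt
    exact ⟨hlt, by rwa [List.getElem_ofFn] at heq⟩
  · rintro ⟨h, rfl⟩
    exact ⟨by rw [List.length_ofFn]; exact h, by rw [List.getElem_ofFn]⟩

omit [Fintype α] [DecidableEq α] in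
/-- A group has no accepted value iff all its values are rejected. [folklore] -/
theorem find?_ofFn_eq_none_iff (f : Fin M → α) :
    (List.ofFn f).find? (fun b => decide (P b)) = none ↔ ∀ j, ¬ P (f j) := by
  rw [List.find?_eq_none]
  simp [List.mem_ofFn]

omit [Fintype α] [DecidableEq α] in
/-- A first accepted value is accepted. [folklore] -/
theorem of_find?_ofFn_eq_some {f : Fin M → α} {a : α} (h : (List.ofFn f).find? (fun b => decide (P b)) = some a) :
    P a := by
  simpa using List.find?_some h

omit [Fintype α] [DecidableEq α] in
/-- **Replacing the first accepted entry** of a group by another accepted value `a'`: the first accepted index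
is unchanged, the first accepted value becomes `a'`, and replacing back restores the group. [folklore] -/
theorem update_first_spec {f : Fin M → α} {a a' : α} (ha' : P a')
    (hf : (List.ofFn f).find? (fun b => decide (P b)) = some a) :
    ∃ hi : (List.ofFn f).findIdx (fun b => decide (P b)) < M,
      (List.ofFn (Function.update f ⟨_, hi⟩ a')).findIdx (fun b => decide (P b)) =
          (List.ofFn f).findIdx (fun b => decide (P b)) ∧
        (List.ofFn (Function.update f ⟨_, hi⟩ a')).find? (fun b => decide (P b)) = some a' ∧
        Function.update (Function.update f ⟨_, hi⟩ a') ⟨_, hi⟩ a = f := by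
  obtain ⟨hi, hfa⟩ := (find?_ofFn_eq_some_iff P f a).1 hf
  set i := (List.ofFn f).findIdx (fun b => decide (P b)) with hi_def
  have hidx : (List.ofFn (Function.update f ⟨i, hi⟩ a')).findIdx (fun b => decide (P b)) = i := by
    rw [List.findIdx_eq (by rw [List.length_ofFn]; exact hi)]
    refine ⟨by simp [List.getElem_ofFn, ha'], fun j hji => ?_⟩
    have hne : (⟨j, hji.trans hi⟩ : Fin M) ≠ ⟨i, hi⟩ := fun h => (Nat.ne_of_lt hji) (congrArg Fin.val h)
    rw [List.getElem_ofFn, Function.update_of_ne hne]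
    have h := List.not_of_lt_findIdx (p := fun b => decide (P b)) (xs := List.ofFn f) (i := j) (hi_def ▸ hji)
    rwa [List.getElem_ofFn] at h
  refine ⟨hi, hidx, ?_, ?_⟩
  · rw [find?_ofFn_eq_some_iff]
    refine ⟨by rw [hidx]; exact hi, ?_⟩
    have : (⟨(List.ofFn (Function.update f ⟨i, hi⟩ a')).findIdx (fun b => decide (P b)), by rw [hidx]; exact hi⟩ :
        Fin M) = ⟨i, hi⟩ := Fin.ext hidx
    rw [this, Function.update_self]
  · rw [Function.update_idem, ← hfa, Function.update_eq_self]

/-- **The fibres of the first accepted value have equal size**: for accepted `a, a'`, as many groups have first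
accepted value `a` as have `a'` (the replacement bijection). [folklore] -/
theorem card_fibre_eq {a a' : α} (ha : P a) (ha' : P a') :
    #(univ.filter fun f : Fin M → α => (List.ofFn f).find? (fun b => decide (P b)) = some a) =
      #(univ.filter fun f : Fin M → α => (List.ofFn f).find? (fun b => decide (P b)) = some a') := by
  -- the total replacement map
  let swap : α → (Fin M → α) → (Fin M → α) := fun b f =>
    if h : (List.ofFn f).findIdx (fun b => decide (P b)) < M then Function.update f ⟨_, h⟩ b else f
  have key : ∀ {b b' : α} {f : Fin M → α}, P b' → (List.ofFn f).find? (fun c => decide (P c)) = some b →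
      (List.ofFn (swap b' f)).find? (fun c => decide (P c)) = some b' ∧ swap b (swap b' f) = f := by
    intro b b' f hb' hf
    obtain ⟨hi, hidx, hfind, hback⟩ := update_first_spec P hb' hf
    have h1 : swap b' f = Function.update f ⟨_, hi⟩ b' := dif_pos hi
    refine ⟨h1 ▸ hfind, ?_⟩
    rw [h1]
    have hi' : (List.ofFn (Function.update f ⟨_, hi⟩ b')).findIdx (fun c => decide (P c)) < M := by
      rw [hidx]; exact hi
    show (if h : _ then _ else _) = f
    rw [dif_pos hi']
    have : (⟨(List.ofFn (Function.update f ⟨_, hi⟩ b')).findIdx (fun c => decide (P c)), hi'⟩ : Fin M) = ⟨_, hi⟩ :=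
      Fin.ext hidx
    rw [this, hback]
  refine card_nbij' (swap a') (swap a) (fun f hf => ?_) (fun f hf => ?_) (fun f hf => ?_) (fun f hf => ?_)
  · simp only [coe_filter, mem_univ, true_and, Set.mem_setOf_eq] at hf ⊢
    exact (key ha' hf).1
  · simp only [coe_filter, mem_univ, true_and, Set.mem_setOf_eq] at hf ⊢
    exact (key ha hf).1
  · simp only [coe_filter, mem_univ, true_and, Set.mem_setOf_eq] at hf
    exact (key ha' hf).2
  · simp only [coe_filter, mem_univ, true_and, Set.mem_setOf_eq] at hf
    exact (key ha hf).2

/-- **Accepted values share the groups**: `#G` times the common fibre size is at most the number of groups.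
[folklore] -/
theorem card_mul_fibre_le {a₀ : α} (ha₀ : P a₀) :
    #(univ.filter P) * #(univ.filter fun f : Fin M → α => (List.ofFn f).find? (fun b => decide (P b)) = some a₀) ≤
      Fintype.card α ^ M := by
  have hdisj : ((univ.filter P : Finset α) : Set α).PairwiseDisjoint fun a =>
      univ.filter fun f : Fin M → α => (List.ofFn f).find? (fun b => decide (P b)) = some a := by
    intro a _ a' _ hne
    refine disjoint_left.2 fun f hf hf' => hne ?_
    simp only [mem_filter, mem_univ, true_and] at hf hf'
    exact Option.some.inj (hf.symm.trans hf')
  calc #(univ.filter P) * #(univ.filter fun f : Fin M → α => (List.ofFn f).find? (fun b => decide (P b)) = some a₀)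
      = ∑ a ∈ univ.filter P, #(univ.filter fun f : Fin M → α =>
          (List.ofFn f).find? (fun b => decide (P b)) = some a) := by
        rw [sum_const_nat fun a ha => ?_]
        exact card_fibre_eq P (mem_filter.1 ha).2 ha₀
    _ = #((univ.filter P).biUnion fun a => univ.filter fun f : Fin M → α =>
          (List.ofFn f).find? (fun b => decide (P b)) = some a) := (card_biUnion hdisj).symm
    _ ≤ #(univ : Finset (Fin M → α)) := card_le_card (subset_univ _)
    _ = Fintype.card α ^ M := by rw [card_univ, Fintype.card_fun, Fintype.card_fin]

omit [DecidableEq α] in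
/-- **A group fails** (no accepted value) in exactly `#(¬G)^M` of the `#α^M` cases. [folklore] -/
theorem card_none_eq :
    #(univ.filter fun f : Fin M → α => (List.ofFn f).find? (fun b => decide (P b)) = none) =
      Fintype.card {a // ¬ P a} ^ M := by
  have h1 : #(univ.filter fun f : Fin M → α => (List.ofFn f).find? (fun b => decide (P b)) = none) =
      Fintype.card {f : Fin M → α // ∀ j, ¬ P (f j)} := by
    rw [Fintype.card_subtype]
    congr 1
    exact filter_congr fun f _ => find?_ofFn_eq_none_iff P f
  rw [h1, Fintype.card_congr (Equiv.subtypePiEquivPi (p := fun _ b => ¬ P b)), Fintype.card_fun, Fintype.card_fin]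

/-! ### `T` groups -/

variable {T : ℕ}

/-- Counting through one coordinate: `#{u | u k ∈ S} · #β = #S · #(Fin T → β)`. [folklore] -/
theorem card_filter_apply_mem {β : Type} [Fintype β] [DecidableEq β] (k : Fin T) (S : Finset β) :
    #(univ.filter fun u : Fin T → β => u k ∈ S) * Fintype.card β = #S * Fintype.card (Fin T → β) := by
  have hΩ : Fintype.card (Fin T → β) = Fintype.card β * Fintype.card ({j // j ≠ k} → β) := by
    rw [Fintype.card_congr (Equiv.funSplitAt k β), Fintype.card_prod]
  have hS : #(univ.filter fun u : Fin T → β => u k ∈ S) = #S * Fintype.card ({j // j ≠ k} → β) := by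
    rw [← card_univ, ← card_product]
    refine card_equiv (Equiv.funSplitAt k β) fun u => ?_
    simp [Equiv.funSplitAt, Equiv.piSplitAt]
  rw [hΩ, hS]
  ring

/-- **The counting bound of rejection sampling.** Among all `u : Fin T → Fin M → α`, those for which SOME group has
no accepted value, or the tuple of first accepted values lies in a set `Bad` of density `≤ β` in `G^T` (`G ≠ ∅`),
number at most `(T · #(¬G)^M / #α^M + β) · #α^{MT}`. [folklore] -/
theorem card_blockRejection_le [Nonempty α] {a₀ : α} (ha₀ : P a₀) (Bad : Finset (Fin T → {a // P a})) {β : ℝ}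
    (hβ : 0 ≤ β) (hbad : (#Bad : ℝ) ≤ β * (Fintype.card {a // P a} : ℝ) ^ T) :
    (#(univ.filter fun u : Fin T → Fin M → α =>
        (∃ k, (List.ofFn (u k)).find? (fun b => decide (P b)) = none) ∨
          ∃ w ∈ Bad, ∀ k, (List.ofFn (u k)).find? (fun b => decide (P b)) = some (w k : α)) : ℝ) ≤
      (T * ((Fintype.card {a // ¬ P a} : ℝ) ^ M / (Fintype.card α : ℝ) ^ M) + β) *
        Fintype.card (Fin T → Fin M → α) := by
  set none_f : Finset (Fin M → α) := univ.filter fun f => (List.ofFn f).find? (fun b => decide (P b)) = none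
  set fib : α → Finset (Fin M → α) := fun a => univ.filter fun f => (List.ofFn f).find? (fun b => decide (P b)) = some a
  have hαM : (0 : ℝ) < (Fintype.card α : ℝ) ^ M := pow_pos (Nat.cast_pos.2 Fintype.card_pos) M
  have hΩ : Fintype.card (Fin T → Fin M → α) = (Fintype.card α ^ M) ^ T := by
    rw [Fintype.card_fun, Fintype.card_fun, Fintype.card_fin, Fintype.card_fin]
  -- (i) some group fails
  have hshort : (#(univ.filter fun u : Fin T → Fin M → α =>
      ∃ k, (List.ofFn (u k)).find? (fun b => decide (P b)) = none) : ℝ) ≤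
      T * ((Fintype.card {a // ¬ P a} : ℝ) ^ M / (Fintype.card α : ℝ) ^ M) * Fintype.card (Fin T → Fin M → α) := by
    have hunion : (univ.filter fun u : Fin T → Fin M → α =>
        ∃ k, (List.ofFn (u k)).find? (fun b => decide (P b)) = none) =
        (univ : Finset (Fin T)).biUnion fun k => univ.filter fun u : Fin T → Fin M → α => u k ∈ none_f := by
      ext u; simp [none_f]
    have hk : ∀ k : Fin T, (#(univ.filter fun u : Fin T → Fin M → α => u k ∈ none_f) : ℝ) =
        (Fintype.card {a // ¬ P a} : ℝ) ^ M / (Fintype.card α : ℝ) ^ M * Fintype.card (Fin T → Fin M → α) := by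
      intro k
      have h := card_filter_apply_mem k none_f
      rw [Fintype.card_fun (α := Fin M), Fintype.card_fin, card_none_eq P] at h
      rw [div_mul_eq_mul_div, eq_div_iff hαM.ne']
      exact_mod_cast h
    rw [hunion]
    calc (#((univ : Finset (Fin T)).biUnion fun k => univ.filter fun u : Fin T → Fin M → α => u k ∈ none_f) : ℝ)
        ≤ ∑ k : Fin T, (#(univ.filter fun u : Fin T → Fin M → α => u k ∈ none_f) : ℝ) := by
          exact_mod_cast card_biUnion_le
      _ = T * ((Fintype.card {a // ¬ P a} : ℝ) ^ M / (Fintype.card α : ℝ) ^ M) * Fintype.card (Fin T → Fin M → α) := by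
          rw [Finset.sum_congr rfl fun k _ => hk k, sum_const, card_univ, Fintype.card_fin, nsmul_eq_mul]; ring
  -- (ii) every group succeeds and the tuple is bad
  have hbadc : (#(univ.filter fun u : Fin T → Fin M → α =>
      ∃ w ∈ Bad, ∀ k, (List.ofFn (u k)).find? (fun b => decide (P b)) = some (w k : α)) : ℝ) ≤
      β * Fintype.card (Fin T → Fin M → α) := by
    -- the common fibre size `κ`
    have hPa₀ : P a₀ := ha₀
    set κ := #(fib a₀) with hκ
    have hG' : #(univ.filter P) = Fintype.card {a // P a} := (Fintype.card_subtype _).symm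
    have hκG : (Fintype.card {a // P a} : ℝ) * κ ≤ (Fintype.card α : ℝ) ^ M := by
      rw [← hG']; exact_mod_cast card_mul_fibre_le P hPa₀
    -- the bad event is the disjoint union over `w ∈ Bad` of product sets of size `κ^T`
    have hdisj : ((Bad : Set (Fin T → {a // P a}))).PairwiseDisjoint fun w =>
        univ.filter fun u : Fin T → Fin M → α => ∀ k, (List.ofFn (u k)).find? (fun b => decide (P b)) = some (w k : α) := by
      intro w _ w' _ hne
      refine disjoint_left.2 fun u hu hu' => hne (funext fun k => Subtype.ext ?_)
      simp only [mem_filter, mem_univ, true_and] at hu hu'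
      exact Option.some.inj ((hu k).symm.trans (hu' k))
    have hprod : ∀ w : Fin T → {a // P a}, #(univ.filter fun u : Fin T → Fin M → α =>
        ∀ k, (List.ofFn (u k)).find? (fun b => decide (P b)) = some (w k : α)) = κ ^ T := by
      intro w
      rw [← Fintype.card_subtype, Fintype.card_congr (Equiv.subtypePiEquivPi (β := fun _ : Fin T => Fin M → α)
        (p := fun k f => (List.ofFn f).find? (fun b => decide (P b)) = some (w k : α))), Fintype.card_pi]
      rw [Finset.prod_congr rfl fun k _ => (Fintype.card_subtype _).trans (card_fibre_eq P (w k).2 hPa₀), prod_const,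
        card_univ, Fintype.card_fin]
    have hunion : (univ.filter fun u : Fin T → Fin M → α =>
        ∃ w ∈ Bad, ∀ k, (List.ofFn (u k)).find? (fun b => decide (P b)) = some (w k : α)) =
        Bad.biUnion fun w => univ.filter fun u : Fin T → Fin M → α =>
          ∀ k, (List.ofFn (u k)).find? (fun b => decide (P b)) = some (w k : α) := by
      ext u; simp
    rw [hunion, card_biUnion hdisj, Finset.sum_congr rfl fun w _ => hprod w, sum_const, smul_eq_mul, Nat.cast_mul,
      Nat.cast_pow, hΩ, Nat.cast_pow, Nat.cast_pow]
    calc (#Bad : ℝ) * (κ : ℝ) ^ T ≤ β * (Fintype.card {a // P a} : ℝ) ^ T * (κ : ℝ) ^ T :=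
          mul_le_mul_of_nonneg_right hbad (by positivity)
      _ = β * ((Fintype.card {a // P a} : ℝ) * κ) ^ T := by rw [mul_pow]; ring
      _ ≤ β * ((Fintype.card α : ℝ) ^ M) ^ T :=
          mul_le_mul_of_nonneg_left (pow_le_pow_left₀ (by positivity) hκG T) hβ
  -- union of (i) and (ii)
  calc (#(univ.filter fun u : Fin T → Fin M → α =>
        (∃ k, (List.ofFn (u k)).find? (fun b => decide (P b)) = none) ∨
          ∃ w ∈ Bad, ∀ k, (List.ofFn (u k)).find? (fun b => decide (P b)) = some (w k : α)) : ℝ)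
      ≤ #(univ.filter fun u : Fin T → Fin M → α => ∃ k, (List.ofFn (u k)).find? (fun b => decide (P b)) = none) +
        #(univ.filter fun u : Fin T → Fin M → α =>
          ∃ w ∈ Bad, ∀ k, (List.ofFn (u k)).find? (fun b => decide (P b)) = some (w k : α)) := by
        rw [filter_or]; exact_mod_cast card_union_le _ _
    _ ≤ _ := by rw [add_mul]; exact add_le_add hshort hbadc

/-! ### Coins -/

/-- Block `j` of group `k` of a coin string of length `T·(M·B)` is the sub-block of the group's chunk. [folklore] -/
theorem toList_chunkVec_chunkVec {B : ℕ} (v : List.Vector Bool (T * (M * B))) (k : Fin T) (j : Fin M) :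
    (chunkVec (chunkVec v k) j).toList = (v.toList.drop ((k * M + j) * B)).take B := by
  show (((v.toList.drop (k * (M * B))).take (M * B)).drop (j * B)).take B = _
  rw [List.drop_take, List.take_take, List.drop_drop]
  have hj : B ≤ M * B - j * B := by
    have : (j + 1) * B ≤ M * B := Nat.mul_le_mul_right B j.isLt
    rw [Nat.succ_mul] at this
    omega
  rw [Nat.min_eq_left hj]
  congr 1
  ring

/-- `uniformProb` is monotone along inclusions checked on strings of the right length. [folklore] -/
theorem uniformProb_mono_len {m : ℕ} {E E' : Set (List Bool)} (h : ∀ w : List Bool, w.length = m → w ∈ E → w ∈ E') :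
    uniformProb m E ≤ uniformProb m E' := by
  classical
  unfold uniformProb
  refine div_le_div_of_nonneg_right ?_ (by positivity)
  exact_mod_cast card_le_card fun r hr => by
    simp only [mem_filter, mem_univ, true_and] at hr ⊢
    exact h _ r.toList_length hr

end BlockRejection

open BlockRejection in
/-- **Rejection sampling from coin blocks.** Read `T` groups of `M` blocks of `B` coins; in group `k` keep the first
block value `v = bitsToNat (block)` with `P v` (all such `v` are `< 2^B`). Then, for any set `Bad` of lists hit by
at most a fraction `β` of the `T`-tuples of accepted values (`G ≠ ∅`): the probability that some group has NO accepted value,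
or that the list of first accepted values lies in `Bad`, is at most `T (1 − #G/2^B)^M + β` (`G = {v | P v}`) — the
union bound for the groups, and, conditioned on all groups succeeding, independence and uniformity on `G` of the
first accepted values. [folklore] -/
theorem uniformProb_blockRejection_le {B T M : ℕ} (P : ℕ → Prop) [DecidablePred P] (hP : ∀ v, P v → v < 2 ^ B)
    (hG0 : ∃ v, P v) (Bad : Set (List ℕ)) {β : ℝ} (hβ : 0 ≤ β)
    (hbad : (Nat.card {w : Fin T → {v : ℕ // P v} // (List.ofFn fun i => (w i : ℕ)) ∈ Bad} : ℝ) ≤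
      β * (Nat.card {v : ℕ // P v} : ℝ) ^ T) :
    uniformProb (T * (M * B)) {c | (∃ k < T, (((List.range M).map fun j =>
          bitsToNat ((c.drop ((k * M + j) * B)).take B)).find? fun v => decide (P v)) = none) ∨
        ((List.range T).filterMap fun k => ((List.range M).map fun j =>
          bitsToNat ((c.drop ((k * M + j) * B)).take B)).find? fun v => decide (P v)) ∈ Bad} ≤
      T * (1 - (Nat.card {v : ℕ // P v} : ℝ) / 2 ^ B) ^ M + β := by
  classical
  -- accepted values as elements of `Fin (2^B)`
  set P' : Fin (2 ^ B) → Prop := fun a => P a.val with hP'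
  let e : {a : Fin (2 ^ B) // P' a} ≃ {v : ℕ // P v} :=
    { toFun := fun a => ⟨a.1.val, a.2⟩
      invFun := fun v => ⟨⟨v.1, hP v.1 v.2⟩, v.2⟩
      left_inv := fun a => by simp
      right_inv := fun v => by simp }
  have hG : Nat.card {v : ℕ // P v} = Fintype.card {a : Fin (2 ^ B) // P' a} := by
    rw [Nat.card_congr e.symm, Nat.card_eq_fintype_card]
  have hGle : Fintype.card {a : Fin (2 ^ B) // P' a} ≤ 2 ^ B :=
    (Fintype.card_subtype_le _).trans (by rw [Fintype.card_fin])
  have hnot : (Fintype.card {a : Fin (2 ^ B) // ¬ P' a} : ℝ) = 2 ^ B - Fintype.card {a : Fin (2 ^ B) // P' a} := by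
    rw [Fintype.card_subtype_compl, Fintype.card_fin, Nat.cast_sub hGle]; norm_num
  -- the bad tuples over `Fin (2^B)`
  set BadF : Finset (Fin T → {a : Fin (2 ^ B) // P' a}) :=
    univ.filter fun w => (List.ofFn fun i => ((w i : Fin (2 ^ B)) : ℕ)) ∈ Bad with hBadF
  have hBadF_card : (#BadF : ℝ) ≤ β * (Fintype.card {a : Fin (2 ^ B) // P' a} : ℝ) ^ T := by
    have hc : #BadF = Nat.card {w : Fin T → {v : ℕ // P v} // (List.ofFn fun i => (w i : ℕ)) ∈ Bad} := by
      rw [hBadF, ← Fintype.card_subtype, ← Nat.card_eq_fintype_card]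
      exact Nat.card_congr ((Equiv.arrowCongr (Equiv.refl (Fin T)) e).subtypeEquiv fun w => by
        simp [Equiv.arrowCongr, e])
    rw [hc, ← hG]; exact hbad
  -- coins ↔ `Fin T → Fin M → Fin (2^B)`
  let decode : List.Vector Bool (T * (M * B)) → (Fin T → Fin M → Fin (2 ^ B)) := fun v k => finTuple (chunkVec v k)
  have hdec : Function.Bijective decode :=
    (Function.Bijective.comp_left (g := finTuple) (finTuple_bijective M B)).comp (chunkVec_bijective T (M * B))
  -- the block values of group `k` are the values of `decode v k`
  have hvals : ∀ (v : List.Vector Bool (T * (M * B))) (k : Fin T),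
      ((List.range M).map fun j => bitsToNat ((v.toList.drop ((k * M + j) * B)).take B)) =
        (List.ofFn (decode v k)).map Fin.val := by
    intro v k
    refine List.ext_getElem (by simp) fun j h₁ h₂ => ?_
    have hj : j < M := by simpa using h₁
    simp only [List.getElem_map, List.getElem_range, List.getElem_ofFn]
    show _ = bitsToNat (chunkVec (chunkVec v k) ⟨j, hj⟩).toList
    rw [toList_chunkVec_chunkVec]
  have hfind : ∀ (v : List.Vector Bool (T * (M * B))) (k : Fin T),
      (((List.range M).map fun j => bitsToNat ((v.toList.drop ((k * M + j) * B)).take B)).find? fun w => decide (P w)) =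
        ((List.ofFn (decode v k)).find? fun a => decide (P' a)).map Fin.val := by
    intro v k; rw [hvals, List.find?_map]; rfl
  -- the coin event is contained in the counted event
  set E' : (Fin T → Fin M → Fin (2 ^ B)) → Prop := fun u =>
    (∃ k, (List.ofFn (u k)).find? (fun b => decide (P' b)) = none) ∨
      ∃ w ∈ BadF, ∀ k, (List.ofFn (u k)).find? (fun b => decide (P' b)) = some (w k : Fin (2 ^ B)) with hE'
  have hsub : ∀ c : List Bool, c.length = T * (M * B) →
      c ∈ {c : List Bool | (∃ k < T, (((List.range M).map fun j =>
          bitsToNat ((c.drop ((k * M + j) * B)).take B)).find? fun v => decide (P v)) = none) ∨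
        ((List.range T).filterMap fun k => ((List.range M).map fun j =>
          bitsToNat ((c.drop ((k * M + j) * B)).take B)).find? fun v => decide (P v)) ∈ Bad} →
      c ∈ {w : List Bool | ∃ h : w.length = T * (M * B), E' (decode ⟨w, h⟩)} := by
    intro c hc hE
    refine ⟨hc, ?_⟩
    set v : List.Vector Bool (T * (M * B)) := ⟨c, hc⟩
    have hcv : c = v.toList := rfl
    rcases hE with ⟨k, hk, hnone⟩ | hB
    · left
      refine ⟨⟨k, hk⟩, ?_⟩
      have h := hfind v ⟨k, hk⟩
      rw [← hcv] at h
      rw [hnone] at h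
      exact Option.map_eq_none_iff.1 h.symm
    · by_cases hshort : ∃ k, (List.ofFn (decode v k)).find? (fun b => decide (P' b)) = none
      · exact Or.inl hshort
      right
      push Not at hshort
      have hsome : ∀ k : Fin T, ∃ a, (List.ofFn (decode v k)).find? (fun b => decide (P' b)) = some a :=
        fun k => Option.ne_none_iff_exists'.1 (hshort k)
      choose a ha using hsome
      have hPa : ∀ k, P' (a k) := fun k => of_find?_ofFn_eq_some P' (ha k)
      refine ⟨fun k => ⟨a k, hPa k⟩, ?_, fun k => ha k⟩
      rw [hBadF, mem_filter]
      refine ⟨mem_univ _, ?_⟩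
      have hlist : ((List.range T).filterMap fun k => ((List.range M).map fun j =>
            bitsToNat ((v.toList.drop ((k * M + j) * B)).take B)).find? fun w => decide (P w)) =
          List.ofFn fun i => ((a i : Fin (2 ^ B)) : ℕ) := by
        rw [← List.map_coe_finRange_eq_range (n := T), List.filterMap_map, List.ofFn_eq_map, ← List.filterMap_eq_map]
        refine List.filterMap_congr fun k _ => ?_
        simp only [Function.comp_apply, hfind v k, ha k, Option.map_some]
      rw [← hlist]
      exact hB
  -- count
  calc uniformProb (T * (M * B)) _
      ≤ uniformProb (T * (M * B)) {w : List Bool | ∃ h : w.length = T * (M * B), E' (decode ⟨w, h⟩)} :=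
        uniformProb_mono_len hsub
    _ = (#(univ.filter E') : ℝ) / Fintype.card (Fin T → Fin M → Fin (2 ^ B)) :=
        uniformProb_eq_card_of_bijective decode hdec E'
    _ ≤ (T * ((Fintype.card {a : Fin (2 ^ B) // ¬ P' a} : ℝ) ^ M / (Fintype.card (Fin (2 ^ B)) : ℝ) ^ M) + β) := by
        rw [div_le_iff₀ (Nat.cast_pos.2 Fintype.card_pos)]
        obtain ⟨v₀, hv₀⟩ := hG0
        exact card_blockRejection_le P' (a₀ := ⟨v₀, hP v₀ hv₀⟩) hv₀ BadF hβ hBadF_card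
    _ = T * (1 - (Nat.card {v : ℕ // P v} : ℝ) / 2 ^ B) ^ M + β := by
        rw [hnot, Fintype.card_fin, hG, ← div_pow]
        congr 3
        push_cast
        field_simp

end Literature.Computability.Complexity
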